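import Summits.QuantumFields.GaugeBoot.TwistedSlabHaar
import HarnessLib

/-!
# The scalar of the Wilson-weighted Haar average is NEGATIVE at `β < 0` (gauge-boot, L3 negative supplement; SU(3) link reflection at `β < 0`, part 3)

HONEST FRAMING (cell `pub-gaugeboot`, page 1 of every file): the venture produces certified bounds
on lattice expectations at stated coupling, gauge group, dimension and torus size; NOT a mass gap,
NOT a continuum limit, NOT a string tension; NOT Yang–Mills-summit-bearing (barriers
`FixedCouplingUltralocality`, `PerturbativeInvisibility`). One-variable Haar bookkeeping for a
NEGATIVE structural result (`FrameLinkRPNegativeBeta.lean`).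

`TwistedSlabHaar.lean` shows: for a continuous representation `ρ` with scalar commutant the
Wilson-weighted average `∫ exp(β Re tr ρ(k)) ρ(k) dk` is a scalar `c_β • 1`, and `c_β > 0` for
`β > 0` (`wAvg_wilsonWeight_eq_smul_pos`). This file is the mirror statement on the other side of
`β = 0`:

* `mul_wAvg_wilsonWeight_zero`, **`integral_re_trace_eq_zero`** — for `ρ` with scalar commutant and
  NON-TRIVIAL (`ρ g₀ ≠ 1` for some `g₀`), `∫ Re tr ρ(k) dk = 0`: the plain Haar average
  `P = ∫ ρ(k) dk` is a scalar absorbed by every `ρ(g)` (`ρ(g) P = P`, left invariance), hence `0`;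
* **`integral_wilsonWeight_mul_re_trace_neg`** — `∫ exp(β Re χ_ρ) Re χ_ρ dk < 0` for `β < 0`,
  `N ≥ 1`, `∫ Re χ_ρ = 0`: split `e^{βu} u = u - (1 - e^{βu}) u`, the second integrand is `≥ 0`
  everywhere and `> 0` near `k = 1`;
* **`wAvg_wilsonWeight_eq_smul_neg`** — so the scalar `c_β` of `wAvg ρ w_β` is real and `< 0`
  for every `β < 0` (scalar commutant, non-trivial, `N ≥ 1`).

Consequence used downstream: a slab of the Wilson measure transfers an observable that is a
product of an ODD number `m` of link variables with the factor `c_β^m < 0` at `β < 0` — the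
mechanism by which link reflection positivity fails for `SU(3)` (baryon vertex, `m = 7`).
Everything is `[folklore]`.

References: T. Bröcker, T. tom Dieck, GTM 98 (1985), II §4; K. Osterwalder, E. Seiler,
Ann. Phys. 110 (1978) 440, §2.
-/

noncomputable section

open MeasureTheory Complex
open scoped Matrix ComplexConjugate
open Literature.MathematicalPhysics.QuantumFieldTheory (haarProbability)
open Literature.RepresentationTheory.CompactGroups

namespace Summit.QuantumFields.GaugeBoot

namespace TwistedSlab

variable {G : Type*} [Group G] [TopologicalSpace G] [IsTopologicalGroup G] [CompactSpace G]
  [MeasurableSpace G] [BorelSpace G] {N : ℕ} (ρ : G →* Matrix (Fin N) (Fin N) ℂ)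

/-! ## Non-trivial representations with scalar commutant have `∫ Re χ = 0` -/

omit [TopologicalSpace G] [IsTopologicalGroup G] [CompactSpace G] [MeasurableSpace G] [BorelSpace G] in
/-- The Wilson weight at `β = 0` is `1`. [folklore] -/
@[simp] theorem wilsonWeight_zero (k : G) : wilsonWeight ρ 0 k = 1 := by
  simp [wilsonWeight]

/-- **The plain Haar average is absorbed by the representation**:
`ρ(g) · ∫ ρ(k) dk = ∫ ρ(k) dk` (left invariance of Haar measure). [folklore] -/
theorem mul_wAvg_wilsonWeight_zero (hρ : Continuous ρ) (g : G) :
    ρ g * wAvg ρ (wilsonWeight ρ 0) = wAvg ρ (wilsonWeight ρ 0) := by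
  have hint : ∀ c e, Integrable (fun k => (wilsonWeight ρ 0 k : ℂ) * ρ k c e) (haarProbability G) :=
    fun c e => (continuous_weight_mul_entry ρ (continuous_wilsonWeight ρ hρ 0) hρ c e).integrable_of_hasCompactSupport
      (HasCompactSupport.of_compactSpace _)
  ext a b
  calc (ρ g * wAvg ρ (wilsonWeight ρ 0)) a b
      = ∑ c, ρ g a c * ∫ k, (wilsonWeight ρ 0 k : ℂ) * ρ k c b ∂(haarProbability G) := by
        simp only [Matrix.mul_apply, wAvg_apply]
    _ = ∫ k, ∑ c, ρ g a c * ((wilsonWeight ρ 0 k : ℂ) * ρ k c b) ∂(haarProbability G) := by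
        rw [integral_finsetSum _ fun c _ => (hint c b).const_mul _]
        exact Finset.sum_congr rfl fun c _ => (integral_const_mul _ _).symm
    _ = ∫ k, (wilsonWeight ρ 0 (g * k) : ℂ) * ρ (g * k) a b ∂(haarProbability G) := by
        refine integral_congr_ae (ae_of_all _ fun k => ?_)
        simp only [wilsonWeight_zero, Complex.ofReal_one, one_mul, map_mul, Matrix.mul_apply]
    _ = ∫ k, (wilsonWeight ρ 0 k : ℂ) * ρ k a b ∂(haarProbability G) :=
        integral_mul_left_eq_self (fun k => (wilsonWeight ρ 0 k : ℂ) * ρ k a b) g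
    _ = wAvg ρ (wilsonWeight ρ 0) a b := by rw [wAvg_apply]

/-- **A non-trivial representation with scalar commutant has `∫ Re tr ρ(k) dk = 0`**: the Haar
average `P = ∫ ρ dk = c • 1` satisfies `ρ(g₀) P = P` with `ρ(g₀) ≠ 1`, so `c = 0`, and
`∫ Re χ = Re tr P`. [folklore] -/
theorem integral_re_trace_eq_zero (hirr : HasScalarCommutant ρ) (hρ : Continuous ρ)
    (hρ1 : ∃ g, ρ g ≠ 1) :
    ∫ k, ((ρ k).trace).re ∂(haarProbability G) = 0 := by
  obtain ⟨c, hc⟩ := exists_wAvg_eq_smul ρ hirr (continuous_wilsonWeight ρ hρ 0)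
    (wilsonWeight_conj ρ 0) hρ
  obtain ⟨g₀, hg₀⟩ := hρ1
  -- `c = 0`
  have hc0 : c = 0 := by
    have h := mul_wAvg_wilsonWeight_zero ρ hρ g₀
    rw [hc, Matrix.mul_smul, Matrix.mul_one] at h
    -- `c • ρ g₀ = c • 1`
    by_contra hcne
    exact hg₀ (smul_right_injective (Matrix (Fin N) (Fin N) ℂ) hcne h)
  -- `∫ Re χ = Re tr (wAvg) = 0`
  have htr := trace_wAvg_wilsonWeight ρ hρ 0
  rw [hc, hc0, zero_smul, Matrix.trace_zero] at htr
  have h2 : (∫ k, wilsonWeight ρ 0 k * ((ρ k).trace).re ∂(haarProbability G)) = 0 := by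
    exact_mod_cast htr.symm
  simpa [wilsonWeight_zero] using h2

/-! ## Negativity of `∫ exp(β Re χ) Re χ` and of the scalar `c_β` at `β < 0` -/

/-- **`∫ exp(β Re χ_ρ) Re χ_ρ dk < 0` for `β < 0`, `N ≥ 1` and `∫ Re χ_ρ = 0`**: write
`e^{βu} u = u - (1 - e^{βu}) u`; the second integrand is `≥ 0` everywhere (`β < 0`) and `> 0`
near `k = 1` (where `u = N > 0`). [folklore] -/
theorem integral_wilsonWeight_mul_re_trace_neg (hρ : Continuous ρ) {β : ℝ} (hβ : β < 0) (hN : 1 ≤ N)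
    (h0 : ∫ k, ((ρ k).trace).re ∂(haarProbability G) = 0) :
    ∫ k, wilsonWeight ρ β k * ((ρ k).trace).re ∂(haarProbability G) < 0 := by
  have huc : Continuous fun k => ((ρ k).trace).re := Complex.continuous_re.comp hρ.matrix_trace
  have hwc := continuous_wilsonWeight ρ hρ β
  have hsplit : ∀ k, wilsonWeight ρ β k * ((ρ k).trace).re =
      ((ρ k).trace).re - (1 - wilsonWeight ρ β k) * ((ρ k).trace).re := fun k => by ring
  have hI1 : Integrable (fun k => ((ρ k).trace).re) (haarProbability G) :=
    huc.integrable_of_hasCompactSupport (HasCompactSupport.of_compactSpace _)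
  have hc2 : Continuous fun k => (1 - wilsonWeight ρ β k) * ((ρ k).trace).re :=
    (continuous_const.sub hwc).mul huc
  have hI2 : Integrable (fun k => (1 - wilsonWeight ρ β k) * ((ρ k).trace).re) (haarProbability G) :=
    hc2.integrable_of_hasCompactSupport (HasCompactSupport.of_compactSpace _)
  simp_rw [hsplit]
  rw [integral_sub hI1 hI2, h0, zero_sub, neg_lt_zero]
  -- the subtracted integrand is nonnegative and positive on a neighbourhood of `1`
  have hnn : ∀ k, 0 ≤ (1 - wilsonWeight ρ β k) * ((ρ k).trace).re := by
    intro k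
    by_cases hk : 0 ≤ ((ρ k).trace).re
    · refine mul_nonneg (sub_nonneg.2 ?_) hk
      exact Real.exp_le_one_iff.2 (mul_nonpos_of_nonpos_of_nonneg hβ.le hk)
    · push Not at hk
      refine mul_nonneg_of_nonpos_of_nonpos (sub_nonpos.2 ?_) hk.le
      exact Real.one_le_exp_iff.2 (mul_nonneg_of_nonpos_of_nonpos hβ.le hk.le)
  rw [integral_pos_iff_support_of_nonneg (fun k => hnn k) hI2]
  have hopen : IsOpen {k : G | 0 < ((ρ k).trace).re} := isOpen_lt continuous_const huc
  have h1 : (1 : G) ∈ {k : G | 0 < ((ρ k).trace).re} := by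
    show 0 < ((ρ 1).trace).re
    simp only [map_one, Matrix.trace_one, Fintype.card_fin, Complex.natCast_re]
    exact_mod_cast hN
  refine lt_of_lt_of_le (hopen.measure_pos (haarProbability G) ⟨1, h1⟩) (measure_mono fun k hk => ?_)
  rw [Function.mem_support]
  have hk' : 0 < ((ρ k).trace).re := hk
  refine (mul_pos (sub_pos.2 ?_) hk').ne'
  exact Real.exp_lt_one_iff.2 (mul_neg_of_neg_of_pos hβ hk')

/-- **The scalar of the Wilson-weighted average is real and NEGATIVE at `β < 0`**: if `ρ` is
continuous, non-trivial, with scalar commutant and `N ≥ 1`, then for every `β < 0`,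
`wAvg ρ w_β = c • 1` with `c = (∫ w_β Re χ_ρ) / N < 0`. [folklore] -/
theorem wAvg_wilsonWeight_eq_smul_neg (hirr : HasScalarCommutant ρ) (hρ : Continuous ρ)
    (hρ1 : ∃ g, ρ g ≠ 1) {β : ℝ} (hβ : β < 0) (hN : 1 ≤ N) :
    ∃ c : ℝ, c < 0 ∧ wAvg ρ (wilsonWeight ρ β) = ((c : ℂ)) • (1 : Matrix (Fin N) (Fin N) ℂ) := by
  obtain ⟨c, hc⟩ := exists_wAvg_eq_smul ρ hirr (continuous_wilsonWeight ρ hρ β)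
    (wilsonWeight_conj ρ β) hρ
  have htr := trace_wAvg_wilsonWeight ρ hρ β
  rw [hc, Matrix.trace_smul, Matrix.trace_one, Fintype.card_fin, smul_eq_mul] at htr
  have hNc : (N : ℂ) ≠ 0 := by exact_mod_cast (show N ≠ 0 by omega)
  have hc' : c = ((∫ k, wilsonWeight ρ β k * ((ρ k).trace).re ∂(haarProbability G)) / N : ℝ) := by
    rw [Complex.ofReal_div, Complex.ofReal_natCast, ← htr, mul_div_cancel_right₀ _ hNc]
  have hNpos : (0 : ℝ) < N := by exact_mod_cast (show 0 < N by omega)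
  refine ⟨_, div_neg_of_neg_of_pos (integral_wilsonWeight_mul_re_trace_neg ρ hρ hβ hN
    (integral_re_trace_eq_zero ρ hirr hρ hρ1)) hNpos, ?_⟩
  rw [hc, hc']

/-- **The scalar is real at every `β`** (same hypotheses, any real `β`): `wAvg ρ w_β = c • 1` with
`c = (∫ w_β Re χ_ρ) / N`; `c < 0` for `β < 0`, `c = 0` at `β = 0` (non-trivial `ρ`), `c > 0` for
`β > 0` (`wAvg_wilsonWeight_eq_smul_pos`). [folklore] -/
theorem wAvg_wilsonWeight_eq_smul_real (hirr : HasScalarCommutant ρ) (hρ : Continuous ρ) (hN : 1 ≤ N)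
    (β : ℝ) :
    wAvg ρ (wilsonWeight ρ β) =
      (((∫ k, wilsonWeight ρ β k * ((ρ k).trace).re ∂(haarProbability G)) / N : ℝ) : ℂ) •
        (1 : Matrix (Fin N) (Fin N) ℂ) := by
  obtain ⟨c, hc⟩ := exists_wAvg_eq_smul ρ hirr (continuous_wilsonWeight ρ hρ β)
    (wilsonWeight_conj ρ β) hρ
  have htr := trace_wAvg_wilsonWeight ρ hρ β
  rw [hc, Matrix.trace_smul, Matrix.trace_one, Fintype.card_fin, smul_eq_mul] at htr
  have hNc : (N : ℂ) ≠ 0 := by exact_mod_cast (show N ≠ 0 by omega)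
  have hc' : c = ((∫ k, wilsonWeight ρ β k * ((ρ k).trace).re ∂(haarProbability G)) / N : ℝ) := by
    rw [Complex.ofReal_div, Complex.ofReal_natCast, ← htr, mul_div_cancel_right₀ _ hNc]
  rw [hc, hc']

end TwistedSlab

end Summit.QuantumFields.GaugeBoot

end
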